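import Literature.AlgebraicGeometry.HodgeTheory.CMHodgeGroupTwistEnvelope
import Literature.AlgebraicGeometry.HodgeTheory.CMHodgeGroupCentreWeil
import HarnessLib

/-!
# The LIFT property for a CM field acting with multiplicity `3` and two MIXED places of equal weight, under «no Weil-type
# quadratic element» (the quartic CM patterns `(2,1)+(2,1)`, `(2,1)+(1,2)` off Weil type): no twist between the
# `𝔰𝔩₃`-blocks of `Lie Hg` (Moonen–Zarhin 1999 §2 (2.3); Ribet 1983 §3)

Family `hodge`, layer `Literature/AlgebraicGeometry/HodgeTheory` (cell `pub-hodgeav-hg6`, req-37 (A) Q2b, TABLE X ROW 10 —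
`End⁰ = E` a quartic CM field, `dim_E H¹ = 3` — second half of the no-twist brick for two mixed places; continues
`CMHodgeGroupTwistEnvelope`). UNCONDITIONAL (the Weil-type exclusion is an explicit hypothesis on the Hodge structure);
theorems only, no definition, no named fact, no `sorry`. HONEST FRAMING of that cell: HC / HC_AV / HC_CM / H2 NOT proved —
linear algebra of polarized weight-one `ℚ`-Hodge structures.

* §1 `CMNoTwist3.apply_conj_of_adjoint_apply` — the Rosati rule: `a ∈ E` acts on `W_{conj μ k}` by the scalar by which
  `a†` acts on `W_{μ k}`.
* §2 `CMNoTwist3.exists_mul_self_eq_smul_one` — a `ψ`-skew `y ∈ E` acting on the two blocks `W_{μ i₀}`, `W_{μ j}`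
  (`ι = {i₀, j}`) by `a` and `± a` has `y² ∈ ℚ · 1`.
* §3 **`CMNoTwist3.false_of_twist_scalars`** — THE ARITHMETIC END: the rational `t ∈ E` produced by the envelope of a twist
  (`CMTwist.exists_mem_endAlg_of_twist`) contradicts «NO WEIL-TYPE QUADRATIC ELEMENT» (`hnoWeil`: a non-zero `ψ`-skew
  `y ∈ E` with `y² ∈ ℚ·1` has `Tr(y_ℂ Θ) ≠ 0`) when the two places have EQUAL weight `t_{i₀}² = t_j²`: with `y = t − t†`
  (skew, non-zero since `t ∉ ℚ·1`, `τ_j(y) = ± τ_{i₀}(y)`, `y² ∈ ℚ·1`) and `y′ = y b₁` (`b₁ ∈ E₀` with `b₁ = ∓`-antisymmetric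
  scalars `β, −β` on the two places, built from `φ + φ†` or `φφ†` minus a rational scalar), one has
  `Tr(y_ℂ Θ) · Tr(y′_ℂ Θ) = c · (t_{i₀}² − t_j²) = 0`.
* §4 **`CMNoTwist3.lift_of_two_mixed`** — THE LIFT PROPERTY for `|ι| ≤ 2`, `n₀ = 3`, two mixed places of equal weight,
  under `hnoWeil`: Ribet's Lie lemma at `d = 3` leaves LIFT or a twist; a twist is excluded by §3.

## References
* [MoonenZarhin1999LowDim] B. Moonen, Yu. Zarhin, Math. Ann. 315 (1999), §2 (2.3) (the Weil-type exception `k ⊂ E`).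
* [Ribet1983] K. A. Ribet, Amer. J. Math. 105 (1983), §3, Thm. 0.
* [Deligne1982HodgeCycles] P. Deligne, LNM 900 (1982), I §3 (proof of Prop. 3.4), §4 (p. 30).
-/

noncomputable section

open scoped TensorProduct
open Module Matrix

namespace Literature.AlgebraicGeometry.Motives

namespace HodgeStructure

universe u

variable {V : Type u} [AddCommGroup V] [Module ℚ V] {n : ℤ}

/-- Rational scalars act on `V_ℂ` through `ℚ ⊆ ℂ`. [folklore] -/
private theorem CMNoTwist3.ratCast_smul (q : ℚ) (z : ℂ ⊗[ℚ] V) : (q : ℂ) • z = q • z := by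
  rw [← algebraMap_smul ℂ q z, eq_ratCast]

section Hodge

variable [Module.Finite ℚ V] [HodgeTensorFacts.{u, u}]

/-! ### §1 The Rosati rule on conjugate blocks -/

/-- **`a` acts on `W_{conj μ k}` by the scalar by which `a†` acts on `W_{μ k}`** (`a ∈ E`; `ψ_ℂ((a†)_ℂ x, y) = ψ_ℂ(x, a_ℂ y)`
against an adapted dual basis). [cite: MoonenZarhin1999LowDim, §1] [cite: Deligne1982HodgeCycles, §4 (p. 30)] -/
theorem CMNoTwist3.apply_conj_of_adjoint_apply {ι : Type} [Fintype ι] [DecidableEq ι] (H : HodgeStructure V n)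
    (hn : n = 1) (heff : H.IsEffective) (ψ : H.Polarization) {φ : Module.End ℚ V} (hφE : φ ∈ H.endAlg) {m : ℕ}
    (hE : ∀ a ∈ H.endAlg, ∃ q : Fin m → ℚ, a = ∑ k, q k • φ ^ (k : ℕ))
    (μ : ι → ℂ) (hinj : Function.Injective μ) (hdist : ∀ k k', μ k' ≠ starRingEnd ℂ (μ k)) {n₀ : ℕ} (hn₀ : n₀ ≠ 0)
    (hrank : ∀ k, Module.finrank ℂ ↥(Module.End.eigenspace (φ.baseChange ℂ) (μ k) ⊓ H.piece 1 0) +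
      Module.finrank ℂ ↥(Module.End.eigenspace (φ.baseChange ℂ) (μ k) ⊓ H.piece 0 1) = n₀)
    (htop : (⨆ kt : ι × Fin 2, Module.End.eigenspace (φ.baseChange ℂ)
      (if kt.2 = 0 then μ kt.1 else starRingEnd ℂ (μ kt.1))) = ⊤)
    {a : Module.End ℚ V} (ha : a ∈ H.endAlg) (k : ι) {s : ℂ}
    (hs : ∀ w ∈ Module.End.eigenspace (φ.baseChange ℂ) (μ k), (ψ.adjoint a).baseChange ℂ w = s • w) :
    ∀ w ∈ Module.End.eigenspace (φ.baseChange ℂ) (starRingEnd ℂ (μ k)), a.baseChange ℂ w = s • w := by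
  classical
  obtain ⟨cb, κ, hcbW, hcbW', -, -, hdual, -⟩ :=
    CMTheta.exists_adaptedDualBasis H hn heff ψ hφE hE μ hinj hdist hrank htop
  obtain ⟨s', hs'⟩ := CMTheta.exists_smul_of_mem_endAlg H hE ha (starRingEnd ℂ (μ k))
  set j₀ : Fin n₀ := ⟨0, Nat.pos_of_ne_zero hn₀⟩ with hj₀
  have h1 : ψ.form.baseChange ℂ (cb ((k, 0), j₀)) (cb ((k, 1), j₀)) = 1 := by rw [hdual, if_pos ⟨rfl, rfl⟩]
  have h := ψ.form_baseChange_adjoint_left a (cb ((k, 0), j₀)) (cb ((k, 1), j₀))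
  rw [hs _ (hcbW k j₀), hs' _ (hcbW' k j₀), map_smul, map_smul, LinearMap.smul_apply, smul_eq_mul, smul_eq_mul, h1,
    mul_one, mul_one] at h
  intro w hw
  rw [hs' w hw, ← h]

/-! ### §2 A skew element with values `(a, ± a)` on the two places squares into `ℚ · 1` -/

/-- **`y² ∈ ℚ · 1`** for a `ψ`-skew `y ∈ E` acting on `W_{μ i₀}` by `a` and on `W_{μ j}` by `± a`, `ι = {i₀, j}`: `y²`
acts by `a²` on an adapted dual basis (the conjugate blocks carry `−(± a)`), so `a² = Tr_ℚ(y²)/dim ∈ ℚ` and `y² = a² · 1`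
(`CMArith.eq_smul_one_of_apply_eq_smul`). [cite: MoonenZarhin1999LowDim, §1] -/
theorem CMNoTwist3.exists_mul_self_eq_smul_one {ι : Type} [Fintype ι] [DecidableEq ι] (hι : Fintype.card ι ≤ 2)
    (H : HodgeStructure V n) (hn : n = 1) (heff : H.IsEffective) (ψ : H.Polarization) {φ : Module.End ℚ V}
    (hφE : φ ∈ H.endAlg) {m : ℕ} (hE : ∀ a ∈ H.endAlg, ∃ q : Fin m → ℚ, a = ∑ k, q k • φ ^ (k : ℕ))
    (hdiv : ∀ a ∈ H.endAlg, a ≠ 0 → ∃ b : Module.End ℚ V, b * a = 1)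
    (μ : ι → ℂ) (hinj : Function.Injective μ) (hdist : ∀ k k', μ k' ≠ starRingEnd ℂ (μ k)) {n₀ : ℕ} (hn₀ : n₀ ≠ 0)
    (hrank : ∀ k, Module.finrank ℂ ↥(Module.End.eigenspace (φ.baseChange ℂ) (μ k) ⊓ H.piece 1 0) +
      Module.finrank ℂ ↥(Module.End.eigenspace (φ.baseChange ℂ) (μ k) ⊓ H.piece 0 1) = n₀)
    (htop : (⨆ kt : ι × Fin 2, Module.End.eigenspace (φ.baseChange ℂ)
      (if kt.2 = 0 then μ kt.1 else starRingEnd ℂ (μ kt.1))) = ⊤)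
    (i₀ j : ι) (hj : j ≠ i₀) {y : Module.End ℚ V} (hyE : y ∈ H.endAlg)
    (hyskew : ∀ v w, ψ.form (y v) w + ψ.form v (y w) = 0) {a : ℂ}
    (hyi : ∀ w ∈ Module.End.eigenspace (φ.baseChange ℂ) (μ i₀), y.baseChange ℂ w = a • w)
    (hyj : (∀ w ∈ Module.End.eigenspace (φ.baseChange ℂ) (μ j), y.baseChange ℂ w = a • w) ∨
      (∀ w ∈ Module.End.eigenspace (φ.baseChange ℂ) (μ j), y.baseChange ℂ w = -a • w)) :
    ∃ q : ℚ, y * y = q • 1 := by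
  classical
  haveI : Module.Free ℚ V := Module.Free.of_divisionRing ℚ V
  set F := φ.baseChange ℂ with hF
  have huniv : ∀ i, i = i₀ ∨ i = j := by
    intro i
    by_contra hne
    rw [not_or] at hne
    have h3 : ({i, i₀, j} : Finset ι).card = 3 := by
      rw [Finset.card_insert_of_notMem (by simp [hne.1, hne.2]), Finset.card_insert_of_notMem (by simp [hj.symm]),
        Finset.card_singleton]
    have hle : ({i, i₀, j} : Finset ι).card ≤ Fintype.card ι := Finset.card_le_univ _
    omega
  -- the values `σ k ∈ {a, -a}` of `y` on the blocks `W_{μ k}`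
  have hσex : ∀ k, ∃ s : ℂ, (s = a ∨ s = -a) ∧ ∀ w ∈ Module.End.eigenspace F (μ k), y.baseChange ℂ w = s • w := by
    intro k
    rcases huniv k with rfl | rfl
    · exact ⟨a, Or.inl rfl, hyi⟩
    · rcases hyj with h | h
      · exact ⟨a, Or.inl rfl, h⟩
      · exact ⟨-a, Or.inr rfl, h⟩
  choose σ hσa hσ using hσex
  have hEcomm : ∀ a ∈ H.endAlg, ∀ b ∈ H.endAlg, a * b = b * a := fun a ha b hb =>
    CMThetaCentre.mul_comm_of_hE H hE ha hb
  have hyφ : y.baseChange ℂ * F = F * y.baseChange ℂ := by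
    rw [hF, ← LinearMap.baseChange_mul, hEcomm y hyE φ hφE, LinearMap.baseChange_mul]
  have hyskewC := CMThetaCentre.baseChange_skew H ψ hyskew
  obtain ⟨cb, κ, hcbW, hcbW', -, -, hdual, hiso⟩ :=
    CMTheta.exists_adaptedDualBasis H hn heff ψ hφE hE μ hinj hdist hrank htop
  have hfin : ∀ k, Module.finrank ℂ ↥(Module.End.eigenspace F (μ k)) = n₀ := fun k => by
    rw [hF, CMTheta.finrank_eigenspace_eq_add H hn heff hφE, hrank k]
  have hfin' : ∀ k, Module.finrank ℂ ↥(Module.End.eigenspace F (starRingEnd ℂ (μ k))) = n₀ := fun k => by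
    rw [← hfin k, hF, ← finrank_eigenspace_baseChange_conj_eq starRingAut φ (μ k), starRingAut_apply,
      starRingEnd_apply]
  have he1 : ∀ k : ι, Function.Injective (fun l : Fin n₀ => (((k, (1 : Fin 2)), l) : (ι × Fin 2) × Fin n₀)) :=
    fun k l l' h => by simpa using h
  have hW'span : ∀ k, Module.End.eigenspace F (starRingEnd ℂ (μ k)) =
      Submodule.span ℂ (Set.range (cb ∘ fun l : Fin n₀ => ((k, (1 : Fin 2)), l))) :=
    fun k => CMArith.eq_span_of_basis cb _ (he1 k) _ (hcbW' k) (hfin' k)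
  have hy0v : ∀ k l, y.baseChange ℂ (cb ((k, 0), l)) = σ k • cb ((k, 0), l) := fun k l => hσ k _ (hcbW k l)
  have hy1v : ∀ k l, y.baseChange ℂ (cb ((k, 1), l)) = -(σ k • cb ((k, 1), l)) :=
    CMArith.apply_eq_neg_smul_of_skew cb (ψ.form.baseChange ℂ) hdual hiso _ σ hy0v hyskewC (fun k l => by
      rw [← hW'span k]
      exact UnitaryTheta.apply_mem_eigenspace_of_commute hyφ (hcbW' k l))
  have huE : y * y ∈ H.endAlg := H.endAlg.mul_mem hyE hyE
  have hu : ∀ i, (y * y).baseChange ℂ (cb i) = (a ^ 2) • cb i := by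
    rintro ⟨⟨k, r⟩, l⟩
    have hsq : σ k * σ k = a ^ 2 := by rcases hσa k with h | h <;> rw [h] <;> ring
    rw [LinearMap.baseChange_mul, Module.End.mul_apply]
    rcases Fin.exists_fin_two.1 ⟨r, rfl⟩ with h | h <;> rw [h]
    · rw [hy0v, map_smul, hy0v, smul_smul, hsq]
    · rw [hy1v, map_neg, map_smul, hy1v, smul_neg, neg_neg, smul_smul, hsq]
  have hcardpos : (Fintype.card ((ι × Fin 2) × Fin n₀) : ℂ) ≠ 0 := by
    have h0 : 0 < Fintype.card ι := Fintype.card_pos_iff.2 ⟨i₀⟩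
    rw [Fintype.card_prod, Fintype.card_prod, Fintype.card_fin, Fintype.card_fin]
    exact_mod_cast (Nat.mul_pos (Nat.mul_pos h0 two_pos) (Nat.pos_of_ne_zero hn₀)).ne'
  have htr : ((LinearMap.trace ℚ V (y * y) : ℚ) : ℂ) = Fintype.card ((ι × Fin 2) × Fin n₀) * a ^ 2 := by
    rw [← eq_ratCast (algebraMap ℚ ℂ), ← LinearMap.trace_baseChange,
      CMArith.trace_eq_sum_of_apply_basis cb _ (fun _ => a ^ 2) hu, Finset.sum_const, Finset.card_univ, nsmul_eq_mul]
  set q : ℚ := LinearMap.trace ℚ V (y * y) / Fintype.card ((ι × Fin 2) × Fin n₀) with hqdef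
  have haq : a ^ 2 = (q : ℂ) := by
    rw [hqdef, Rat.cast_div, Rat.cast_natCast, htr, mul_div_cancel_left₀ _ hcardpos]
  exact ⟨q, CMArith.eq_smul_one_of_apply_eq_smul H hdiv huE (cb.ne_zero ((i₀, 0), ⟨0, Nat.pos_of_ne_zero hn₀⟩))
    (by rw [hu, haq])⟩

/-! ### §3 The arithmetic end: equal weights and «no Weil-type quadratic element» kill the twist scalars -/

/-- **THE TWIST SCALARS CONTRADICT «NO WEIL-TYPE QUADRATIC ELEMENT»** (see the module docstring): `|ι| ≤ 2`, places
`i₀ ≠ j` of equal weight `(dim W^{1,0} − dim W^{0,1})²`, `Θ` the Hodge operator, and a rational `t ∈ E`, not a rational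
scalar, with the scalar relations of `CMTwist.exists_mem_endAlg_of_twist`: impossible under `hnoWeil`.
[cite: MoonenZarhin1999LowDim, §2 (2.3)] [cite: Ribet1983, Thm. 0] -/
theorem CMNoTwist3.false_of_twist_scalars {ι : Type} [Fintype ι] [DecidableEq ι] (hι : Fintype.card ι ≤ 2)
    (H : HodgeStructure V n) (hn : n = 1) (heff : H.IsEffective) (ψ : H.Polarization)
    {φ : Module.End ℚ V} (hφE : φ ∈ H.endAlg) {m : ℕ} (hE : ∀ a ∈ H.endAlg, ∃ q : Fin m → ℚ, a = ∑ k, q k • φ ^ (k : ℕ))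
    (hdiv : ∀ a ∈ H.endAlg, a ≠ 0 → ∃ b : Module.End ℚ V, b * a = 1)
    (μ : ι → ℂ) (hinj : Function.Injective μ) (hdist : ∀ k k', μ k' ≠ starRingEnd ℂ (μ k)) {n₀ : ℕ} (hn₀ : n₀ ≠ 0)
    (hrank : ∀ k, Module.finrank ℂ ↥(Module.End.eigenspace (φ.baseChange ℂ) (μ k) ⊓ H.piece 1 0) +
      Module.finrank ℂ ↥(Module.End.eigenspace (φ.baseChange ℂ) (μ k) ⊓ H.piece 0 1) = n₀)
    (htop : (⨆ kt : ι × Fin 2, Module.End.eigenspace (φ.baseChange ℂ)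
      (if kt.2 = 0 then μ kt.1 else starRingEnd ℂ (μ kt.1))) = ⊤)
    {Θ : Module.End ℂ (ℂ ⊗[ℚ] V)} (hΘ : ∀ p, ∀ x ∈ H.piece p (n - p), Θ x = ((2 * p - n : ℤ) : ℂ) • x)
    (hΘφ : Θ * φ.baseChange ℂ = φ.baseChange ℂ * Θ)
    (hΘskew : ∀ x y, ψ.form.baseChange ℂ (Θ x) y + ψ.form.baseChange ℂ x (Θ y) = 0)
    (i₀ j : ι) (hj : j ≠ i₀)
    (ht : ((Module.finrank ℂ ↥(Module.End.eigenspace (φ.baseChange ℂ) (μ i₀) ⊓ H.piece 1 0) : ℤ) -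
        Module.finrank ℂ ↥(Module.End.eigenspace (φ.baseChange ℂ) (μ i₀) ⊓ H.piece 0 1)) ^ 2 =
      ((Module.finrank ℂ ↥(Module.End.eigenspace (φ.baseChange ℂ) (μ j) ⊓ H.piece 1 0) : ℤ) -
        Module.finrank ℂ ↥(Module.End.eigenspace (φ.baseChange ℂ) (μ j) ⊓ H.piece 0 1)) ^ 2)
    (hnoWeil : ∀ y ∈ H.endAlg, y ≠ 0 → (∀ v w, ψ.form (y v) w + ψ.form v (y w) = 0) →
      (∃ q : ℚ, y * y = q • 1) → LinearMap.trace ℂ _ (y.baseChange ℂ * Θ) ≠ 0)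
    {t : Module.End ℚ V} (htE : t ∈ H.endAlg) (htns : ∀ q : ℚ, t ≠ q • 1) {α β : ℂ}
    (hα : ∀ w ∈ Module.End.eigenspace (φ.baseChange ℂ) (μ i₀), t.baseChange ℂ w = α • w)
    (hβ : ∀ w ∈ Module.End.eigenspace (φ.baseChange ℂ) (μ i₀), (ψ.adjoint t).baseChange ℂ w = β • w)
    (hrel : ((∀ w ∈ Module.End.eigenspace (φ.baseChange ℂ) (μ j), t.baseChange ℂ w = α • w) ∧
          (∀ w ∈ Module.End.eigenspace (φ.baseChange ℂ) (μ j), (ψ.adjoint t).baseChange ℂ w = β • w)) ∨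
        ((∀ w ∈ Module.End.eigenspace (φ.baseChange ℂ) (μ j), (ψ.adjoint t).baseChange ℂ w = α • w) ∧
          (∀ w ∈ Module.End.eigenspace (φ.baseChange ℂ) (μ j), t.baseChange ℂ w = β • w))) : False := by
  classical
  haveI : Module.Free ℚ V := Module.Free.of_divisionRing ℚ V
  set F := φ.baseChange ℂ with hF
  let W : ι → Submodule ℂ (ℂ ⊗[ℚ] V) := fun i => Module.End.eigenspace F (μ i)
  have hWdef : ∀ i, W i = Module.End.eigenspace F (μ i) := fun i => rfl
  have hEcomm : ∀ a ∈ H.endAlg, ∀ b ∈ H.endAlg, a * b = b * a := fun a ha b hb =>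
    CMThetaCentre.mul_comm_of_hE H hE ha hb
  have huniv : ∀ i, i = i₀ ∨ i = j := by
    intro i
    by_contra hne
    rw [not_or] at hne
    have h3 : ({i, i₀, j} : Finset ι).card = 3 := by
      rw [Finset.card_insert_of_notMem (by simp [hne.1, hne.2]), Finset.card_insert_of_notMem (by simp [hj.symm]),
        Finset.card_singleton]
    have hle : ({i, i₀, j} : Finset ι).card ≤ Fintype.card ι := Finset.card_le_univ _
    omega
  have hfin : ∀ i, Module.finrank ℂ ↥(W i) = n₀ := fun i => by
    rw [hWdef, CMTheta.finrank_eigenspace_eq_add H hn heff hφE, hrank i]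
  have hWne : ∀ i, ∃ w ∈ W i, w ≠ 0 := fun i =>
    Submodule.exists_mem_ne_zero_of_ne_bot (fun h => hn₀ (by rw [← hfin i, h, finrank_bot]) : W i ≠ ⊥)
  have ht'E : ψ.adjoint t ∈ H.endAlg := ψ.adjoint_mem_endAlg htE
  /- the skew part `y = t − t†` -/
  obtain ⟨y, hydef⟩ : ∃ y : Module.End ℚ V, y = t - ψ.adjoint t := ⟨_, rfl⟩
  have hyE : y ∈ H.endAlg := by rw [hydef]; exact sub_mem htE ht'E
  have hyskew : ∀ v w, ψ.form (y v) w + ψ.form v (y w) = 0 := fun v w => by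
    rw [hydef, LinearMap.sub_apply, LinearMap.sub_apply, map_sub, LinearMap.sub_apply, map_sub,
      ψ.form_apply_adjoint, ψ.isAdjointPair_adjoint_left t v w]
    ring
  set η : ℂ := α - β with hηdef
  have hyi : ∀ w ∈ W i₀, y.baseChange ℂ w = η • w := fun w hw => by
    rw [hydef, LinearMap.baseChange_sub, LinearMap.sub_apply, hα w hw, hβ w hw, hηdef, sub_smul]
  -- the sign `ε = ± 1` of the twist: `y = ε η` on `W j`
  obtain ⟨ε, hε, hyj⟩ : ∃ ε : ℂ, (ε = 1 ∨ ε = -1) ∧ ∀ w ∈ W j, y.baseChange ℂ w = (ε * η) • w := by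
    rcases hrel with ⟨h1, h2⟩ | ⟨h1, h2⟩
    · exact ⟨1, Or.inl rfl, fun w hw => by
        rw [hydef, LinearMap.baseChange_sub, LinearMap.sub_apply, h1 w hw, h2 w hw, hηdef, one_mul, sub_smul]⟩
    · exact ⟨-1, Or.inr rfl, fun w hw => by
        rw [hydef, LinearMap.baseChange_sub, LinearMap.sub_apply, h2 w hw, h1 w hw, hηdef, neg_one_mul, neg_sub,
          sub_smul]⟩
  have hε2 : ε * ε = 1 := by rcases hε with h | h <;> rw [h] <;> norm_num
  have hyj' : (∀ w ∈ W j, y.baseChange ℂ w = η • w) ∨ (∀ w ∈ W j, y.baseChange ℂ w = -η • w) := by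
    rcases hε with h | h
    · left; intro w hw; rw [hyj w hw, h, one_mul]
    · right; intro w hw; rw [hyj w hw, h, neg_one_mul]
  /- `y ≠ 0`: otherwise `t = t†` acts by `α` on every block, so `t` is a rational scalar -/
  have hη0 : η ≠ 0 := by
    intro hη
    have hαβ : α = β := sub_eq_zero.1 (hηdef ▸ hη)
    -- `t = t†`
    have hy0 : y = 0 := by
      have hyC0 : y.baseChange ℂ = 0 := by
        refine CMThetaSocket.eq_zero_of_forall_eigenspace H hn heff ψ hφE hE μ hinj hdist htop ?_
          (CMThetaCentre.baseChange_skew H ψ hyskew) fun k w hw => ?_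
        · rw [← LinearMap.baseChange_mul, hEcomm y hyE φ hφE, LinearMap.baseChange_mul]
        · rcases huniv k with rfl | rfl
          · rw [hyi w hw, hη, zero_smul]
          · rw [hyj w hw, hη, mul_zero, zero_smul]
      have h : y ∈ (⊥ : Submodule ℚ (Module.End ℚ V)) :=
        mem_of_baseChange_mem_spanC ⊥ (by rw [hyC0]; exact Submodule.zero_mem _)
      exact (Submodule.mem_bot ℚ).1 h
    have htt : ψ.adjoint t = t := by
      have h : t - ψ.adjoint t = 0 := by rw [← hydef, hy0]
      exact (sub_eq_zero.1 h).symm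
    -- `t` acts by `α` on every `W_{μ k}` and every `W_{conj μ k}`
    have htk : ∀ k, ∀ w ∈ W k, t.baseChange ℂ w = α • w := by
      intro k
      rcases huniv k with rfl | rfl
      · exact hα
      · rcases hrel with ⟨h1, -⟩ | ⟨-, h2⟩
        · exact h1
        · intro w hw; rw [h2 w hw, ← hαβ]
    have htk' : ∀ k, ∀ w ∈ Module.End.eigenspace F (starRingEnd ℂ (μ k)), t.baseChange ℂ w = α • w := by
      intro k
      refine CMNoTwist3.apply_conj_of_adjoint_apply H hn heff ψ hφE hE μ hinj hdist hn₀ hrank htop htE k fun w hw => ?_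
      rw [htt]; exact htk k w hw
    -- so `t_ℂ = α · 1`, `α = Tr(t)/dim ∈ ℚ`, `t = q · 1`
    obtain ⟨cb, κ, hcbW, hcbW', -, -, -, -⟩ := CMTheta.exists_adaptedDualBasis H hn heff ψ hφE hE μ hinj hdist hrank htop
    have hu : ∀ i, t.baseChange ℂ (cb i) = α • cb i := by
      rintro ⟨⟨k, r⟩, l⟩
      rcases Fin.exists_fin_two.1 ⟨r, rfl⟩ with h | h <;> rw [h]
      · exact htk k _ (hcbW k l)
      · exact htk' k _ (hcbW' k l)
    have hcardpos : (Fintype.card ((ι × Fin 2) × Fin n₀) : ℂ) ≠ 0 := by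
      have h0 : 0 < Fintype.card ι := Fintype.card_pos_iff.2 ⟨i₀⟩
      rw [Fintype.card_prod, Fintype.card_prod, Fintype.card_fin, Fintype.card_fin]
      exact_mod_cast (Nat.mul_pos (Nat.mul_pos h0 two_pos) (Nat.pos_of_ne_zero hn₀)).ne'
    have htr : ((LinearMap.trace ℚ V t : ℚ) : ℂ) = Fintype.card ((ι × Fin 2) × Fin n₀) * α := by
      rw [← eq_ratCast (algebraMap ℚ ℂ), ← LinearMap.trace_baseChange,
        CMArith.trace_eq_sum_of_apply_basis cb _ (fun _ => α) hu, Finset.sum_const, Finset.card_univ, nsmul_eq_mul]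
    set q : ℚ := LinearMap.trace ℚ V t / Fintype.card ((ι × Fin 2) × Fin n₀) with hqdef
    have haq : α = (q : ℂ) := by
      rw [hqdef, Rat.cast_div, Rat.cast_natCast, htr, mul_div_cancel_left₀ _ hcardpos]
    exact htns q (CMArith.eq_smul_one_of_apply_eq_smul H hdiv htE (cb.ne_zero ((i₀, 0), ⟨0, Nat.pos_of_ne_zero hn₀⟩))
      (by rw [hu, haq]))
  have hy0 : y ≠ 0 := by
    intro h
    obtain ⟨w, hw, hw0⟩ := hWne i₀
    have h1 := hyi w hw
    rw [h, LinearMap.baseChange_zero, LinearMap.zero_apply] at h1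
    exact hη0 ((smul_eq_zero.1 h1.symm).resolve_right hw0)
  /- the symmetric element `b₁ ∈ E₀` with scalars `(β₀, −β₀)`, `β₀ ≠ 0` -/
  have hadj := CMNoTwist.adjoint_baseChange_apply H hn heff ψ hφE hE μ hinj hdist hn₀ hrank htop
  have hφadjE : ψ.adjoint φ ∈ H.endAlg := ψ.adjoint_mem_endAlg hφE
  obtain ⟨b, τ, hbE, hbsym, hbτ, hτ⟩ : ∃ (b : Module.End ℚ V) (τ : ι → ℂ), b ∈ H.endAlg ∧
      (∀ v w, ψ.form (b v) w = ψ.form v (b w)) ∧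
      (∀ i, ∀ w ∈ Module.End.eigenspace F (μ i), b.baseChange ℂ w = τ i • w) ∧ τ i₀ ≠ τ j := by
    by_cases hs : μ i₀ + starRingEnd ℂ (μ i₀) = μ j + starRingEnd ℂ (μ j)
    · refine ⟨φ * ψ.adjoint φ, fun i => μ i * starRingEnd ℂ (μ i), H.endAlg.mul_mem hφE hφadjE, fun v w => ?_,
        fun i w hw => ?_, fun h => ?_⟩
      · rw [Module.End.mul_apply, Module.End.mul_apply, ← ψ.form_apply_adjoint, ψ.isAdjointPair_adjoint_left φ]
      · rw [LinearMap.baseChange_mul, Module.End.mul_apply, hadj i w hw, map_smul, Module.End.mem_eigenspace_iff.1 hw,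
          smul_smul, mul_comm]
      · have hq : (μ j - μ i₀) * (μ j - starRingEnd ℂ (μ i₀)) = 0 := by linear_combination (-(μ j)) * hs + h
        rcases mul_eq_zero.1 hq with h1 | h1
        · exact hj (hinj (sub_eq_zero.1 h1))
        · exact hdist i₀ j (sub_eq_zero.1 h1)
    · refine ⟨φ + ψ.adjoint φ, fun i => μ i + starRingEnd ℂ (μ i), add_mem hφE hφadjE, fun v w => ?_,
        fun i w hw => ?_, hs⟩
      · rw [LinearMap.add_apply, LinearMap.add_apply, map_add, LinearMap.add_apply, map_add, ← ψ.form_apply_adjoint,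
          ψ.isAdjointPair_adjoint_left φ, add_comm]
      · rw [LinearMap.baseChange_add, LinearMap.add_apply, hadj i w hw, Module.End.mem_eigenspace_iff.1 hw, add_smul]
  have hbadj : ψ.adjoint b = b := by
    refine (ψ.eq_adjoint_of_isAdjointPair fun v w => ?_).symm
    exact hbsym v w
  -- the values of `b` on the conjugate blocks are the same (`b† = b`)
  have hbτ' : ∀ k, ∀ w ∈ Module.End.eigenspace F (starRingEnd ℂ (μ k)), b.baseChange ℂ w = τ k • w := fun k =>
    CMNoTwist3.apply_conj_of_adjoint_apply H hn heff ψ hφE hE μ hinj hdist hn₀ hrank htop hbE k fun w hw => by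
      rw [hbadj]; exact hbτ k w hw
  -- `Tr_ℚ(b) = card · (τ i₀ + τ j)/2`
  obtain ⟨cb, κ, hcbW, hcbW', -, -, -, -⟩ := CMTheta.exists_adaptedDualBasis H hn heff ψ hφE hE μ hinj hdist hrank htop
  have hcard2 : Fintype.card ι = 2 := by
    apply le_antisymm hι
    have h := Finset.card_le_univ ({i₀, j} : Finset ι)
    rwa [Finset.card_insert_of_notMem (by simp [hj.symm]), Finset.card_singleton] at h
  set r : ℚ := LinearMap.trace ℚ V b / (4 * n₀) with hrdef
  have hr : (r : ℂ) = (τ i₀ + τ j) / 2 := by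
    have hvals : ∀ i : (ι × Fin 2) × Fin n₀, b.baseChange ℂ (cb i) = τ i.1.1 • cb i := by
      rintro ⟨⟨k, s⟩, l⟩
      rcases Fin.exists_fin_two.1 ⟨s, rfl⟩ with h | h <;> rw [h]
      · exact hbτ k _ (hcbW k l)
      · exact hbτ' k _ (hcbW' k l)
    have htr : ((LinearMap.trace ℚ V b : ℚ) : ℂ) = 2 * n₀ * (τ i₀ + τ j) := by
      rw [← eq_ratCast (algebraMap ℚ ℂ), ← LinearMap.trace_baseChange,
        CMArith.trace_eq_sum_of_apply_basis cb _ (fun i => τ i.1.1) hvals, Fintype.sum_prod_type, Fintype.sum_prod_type]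
      have hinner : ∀ k : ι, ∑ s : Fin 2, ∑ l : Fin n₀, τ ((k, s), l).1.1 = 2 * n₀ * τ k := fun k => by
        simp only [Finset.sum_const, Finset.card_univ, Fintype.card_fin, nsmul_eq_mul, Nat.cast_ofNat]
        ring
      rw [Finset.sum_congr rfl fun k _ => hinner k, Finset.sum_eq_add i₀ j hj.symm (fun k _ hk' => (huniv k).elim
        (fun e => absurd e hk'.1) (fun e => absurd e hk'.2)) (fun h => absurd (Finset.mem_univ i₀) h)
        (fun h => absurd (Finset.mem_univ j) h)]
      ring
    have hn₀C : (n₀ : ℂ) ≠ 0 := Nat.cast_ne_zero.2 hn₀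
    rw [hrdef]
    push_cast
    rw [htr]
    field_simp
    ring
  obtain ⟨b₁, hb₁def⟩ : ∃ b₁ : Module.End ℚ V, b₁ = b - r • 1 := ⟨_, rfl⟩
  set β₀ : ℂ := (τ i₀ - τ j) / 2 with hβ₀def
  have hβ₀ : β₀ ≠ 0 := by
    rw [hβ₀def]; exact div_ne_zero (sub_ne_zero.2 hτ) two_ne_zero
  have hb₁E : b₁ ∈ H.endAlg := by rw [hb₁def]; exact sub_mem hbE (H.endAlg.smul_mem H.endAlg.one_mem r)
  have hb₁i : ∀ w ∈ W i₀, b₁.baseChange ℂ w = β₀ • w := fun w hw => by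
    rw [hb₁def, LinearMap.baseChange_sub, LinearMap.sub_apply, hbτ i₀ w hw, LinearMap.baseChange_smul,
      LinearMap.smul_apply, LinearMap.baseChange_one, Module.End.one_apply, ← CMNoTwist3.ratCast_smul, hr, ← sub_smul,
      hβ₀def]
    congr 1; ring
  have hb₁j : ∀ w ∈ W j, b₁.baseChange ℂ w = (-β₀) • w := fun w hw => by
    rw [hb₁def, LinearMap.baseChange_sub, LinearMap.sub_apply, hbτ j w hw, LinearMap.baseChange_smul,
      LinearMap.smul_apply, LinearMap.baseChange_one, Module.End.one_apply, ← CMNoTwist3.ratCast_smul, hr, ← sub_smul,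
      hβ₀def]
    congr 1; ring
  have hb₁sym : ∀ v w, ψ.form (b₁ v) w = ψ.form v (b₁ w) := fun v w => by
    rw [hb₁def, LinearMap.sub_apply, LinearMap.sub_apply, map_sub, LinearMap.sub_apply, map_sub, hbsym,
      LinearMap.smul_apply, LinearMap.smul_apply, Module.End.one_apply, Module.End.one_apply, map_smul,
      LinearMap.smul_apply, map_smul]
  /- the second skew element `y′ = y b₁` -/
  obtain ⟨y', hy'def⟩ : ∃ y' : Module.End ℚ V, y' = y * b₁ := ⟨_, rfl⟩
  have hy'E : y' ∈ H.endAlg := by rw [hy'def]; exact H.endAlg.mul_mem hyE hb₁E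
  have hy'skew : ∀ v w, ψ.form (y' v) w + ψ.form v (y' w) = 0 := fun v w => by
    have h1 := hyskew (b₁ v) w
    have h2 := hb₁sym v (y w)
    rw [hy'def, Module.End.mul_apply, hEcomm y hyE b₁ hb₁E, Module.End.mul_apply]
    linear_combination h1 - h2
  have hy'i : ∀ w ∈ W i₀, y'.baseChange ℂ w = (η * β₀) • w := fun w hw => by
    rw [hy'def, LinearMap.baseChange_mul, Module.End.mul_apply, hb₁i w hw, map_smul,
      hyi w hw, smul_smul, mul_comm]
  have hy'j : ∀ w ∈ W j, y'.baseChange ℂ w = (-(ε * (η * β₀))) • w := fun w hw => by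
    rw [hy'def, LinearMap.baseChange_mul, Module.End.mul_apply, hb₁j w hw, map_smul, hyj w hw, smul_smul]
    congr 1; ring
  have hy'j' : (∀ w ∈ W j, y'.baseChange ℂ w = (η * β₀) • w) ∨ (∀ w ∈ W j, y'.baseChange ℂ w = -(η * β₀) • w) := by
    rcases hε with h | h
    · right; intro w hw; rw [hy'j w hw, h, one_mul]
    · left; intro w hw; rw [hy'j w hw, h, neg_one_mul, neg_neg]
  have hy'0 : y' ≠ 0 := by
    intro h
    obtain ⟨w, hw, hw0⟩ := hWne i₀
    have h1 := hy'i w hw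
    rw [h, LinearMap.baseChange_zero, LinearMap.zero_apply] at h1
    exact mul_ne_zero hη0 hβ₀ ((smul_eq_zero.1 h1.symm).resolve_right hw0)
  /- the squares are rational scalars -/
  have hysq := CMNoTwist3.exists_mul_self_eq_smul_one hι H hn heff ψ hφE hE hdiv μ hinj hdist hn₀ hrank htop i₀ j hj
    hyE hyskew hyi hyj'
  have hy'sq := CMNoTwist3.exists_mul_self_eq_smul_one hι H hn heff ψ hφE hE hdiv μ hinj hdist hn₀ hrank htop i₀ j hj
    hy'E hy'skew hy'i hy'j'
  /- the traces `Tr(y Θ)`, `Tr(y′ Θ)` -/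
  set tw : ι → ℂ := fun k => ((Module.finrank ℂ ↥(Module.End.eigenspace F (μ k) ⊓ H.piece 1 0) : ℂ) -
    (Module.finrank ℂ ↥(Module.End.eigenspace F (μ k) ⊓ H.piece 0 1) : ℂ)) with htwdef
  have htw2 : tw i₀ ^ 2 = tw j ^ 2 := by
    have h := congrArg (fun z : ℤ => (z : ℂ)) ht
    simpa [htwdef] using h
  -- `σ`, `σ′` as functions on `ι`
  have hσex : ∃ σ : ι → ℂ, (∀ k, ∀ w ∈ Module.End.eigenspace F (μ k), y.baseChange ℂ w = σ k • w) ∧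
      σ i₀ = η ∧ σ j = ε * η := by
    refine ⟨Function.update (fun _ => ε * η) i₀ η, fun k w hw => ?_, Function.update_self _ _ _,
      by rw [Function.update_of_ne hj]⟩
    rcases huniv k with rfl | rfl
    · rw [Function.update_self]; exact hyi w hw
    · rw [Function.update_of_ne hj]; exact hyj w hw
  obtain ⟨σ, hσ, hσi, hσj⟩ := hσex
  have hσ'ex : ∃ σ' : ι → ℂ, (∀ k, ∀ w ∈ Module.End.eigenspace F (μ k), y'.baseChange ℂ w = σ' k • w) ∧
      σ' i₀ = η * β₀ ∧ σ' j = -(ε * (η * β₀)) := by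
    refine ⟨Function.update (fun _ => -(ε * (η * β₀))) i₀ (η * β₀), fun k w hw => ?_, Function.update_self _ _ _,
      by rw [Function.update_of_ne hj]⟩
    rcases huniv k with rfl | rfl
    · rw [Function.update_self]; exact hy'i w hw
    · rw [Function.update_of_ne hj]; exact hy'j w hw
  obtain ⟨σ', hσ', hσ'i, hσ'j⟩ := hσ'ex
  have hsum2 : ∀ f : ι → ℂ, ∑ k, f k = f i₀ + f j := fun f =>
    Finset.sum_eq_add i₀ j hj.symm (fun k _ hk' => (huniv k).elim (fun e => absurd e hk'.1) (fun e => absurd e hk'.2))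
      (fun h => absurd (Finset.mem_univ i₀) h) (fun h => absurd (Finset.mem_univ j) h)
  have htr1 : LinearMap.trace ℂ _ (y.baseChange ℂ * Θ) = 2 * (η * tw i₀ + ε * η * tw j) := by
    rw [CMThetaCentre.trace_baseChange_mul_theta H hn heff ψ hφE hE μ hinj hdist hrank htop hΘ hΘφ hΘskew hyskew σ hσ,
      hsum2, hσi, hσj]
  have htr2 : LinearMap.trace ℂ _ (y'.baseChange ℂ * Θ) = 2 * (η * β₀ * tw i₀ + -(ε * (η * β₀)) * tw j) := by
    rw [CMThetaCentre.trace_baseChange_mul_theta H hn heff ψ hφE hE μ hinj hdist hrank htop hΘ hΘφ hΘskew hy'skew σ'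
      hσ', hsum2, hσ'i, hσ'j]
  have h1 := hnoWeil y hyE hy0 hyskew hysq
  have h2 := hnoWeil y' hy'E hy'0 hy'skew hy'sq
  rw [htr1] at h1
  rw [htr2] at h2
  -- the product of the two non-zero traces is `c · (tw i₀² − tw j²) = 0`
  have hprod : (2 * (η * tw i₀ + ε * η * tw j)) * (2 * (η * β₀ * tw i₀ + -(ε * (η * β₀)) * tw j)) =
      4 * η ^ 2 * β₀ * (tw i₀ ^ 2 - ε * ε * tw j ^ 2) := by ring
  rw [hε2, one_mul, htw2, sub_self, mul_zero] at hprod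
  exact (mul_ne_zero h1 h2) hprod

/-! ### §4 The LIFT property for two mixed places of equal weight -/

/-- **THE LIFT PROPERTY FOR `n₀ = 3` AND TWO MIXED PLACES OF EQUAL WEIGHT, UNDER «NO WEIL-TYPE QUADRATIC ELEMENT»**
(see the module docstring; `|ι| ≤ 2`, every place mixed, `(dim W_{μ k}^{1,0} − dim W_{μ k}^{0,1})²` the same at the two
places, `𝔤` bracket-closed admissible with `Θ ∈ 𝔤_ℂ` and every `W_{μ k}` `𝔤`-irreducible): for every `k` and every
traceless `Z ∈ End(W_{μ k})` there is `X ∈ 𝔤_ℂ` inducing `Z` on `W_{μ k}` and `0` on the other block.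
[cite: MoonenZarhin1999LowDim, §2 (2.3)] [cite: Ribet1983, §3 and Thm. 0] [cite: Deligne1982HodgeCycles, I §3 (proof of Prop. 3.4)] -/
theorem CMNoTwist3.lift_of_two_mixed {ι : Type} [Fintype ι] [DecidableEq ι] (hι : Fintype.card ι ≤ 2)
    (H : HodgeStructure V n) (hn : n = 1) (heff : H.IsEffective) (ψ : H.Polarization)
    {φ : Module.End ℚ V} (hφE : φ ∈ H.endAlg) {m : ℕ} (hE : ∀ a ∈ H.endAlg, ∃ q : Fin m → ℚ, a = ∑ k, q k • φ ^ (k : ℕ))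
    (hdiv : ∀ a ∈ H.endAlg, a ≠ 0 → ∃ b : Module.End ℚ V, b * a = 1)
    (μ : ι → ℂ) (hinj : Function.Injective μ) (hdist : ∀ k k', μ k' ≠ starRingEnd ℂ (μ k))
    (hrank : ∀ k, Module.finrank ℂ ↥(Module.End.eigenspace (φ.baseChange ℂ) (μ k) ⊓ H.piece 1 0) +
      Module.finrank ℂ ↥(Module.End.eigenspace (φ.baseChange ℂ) (μ k) ⊓ H.piece 0 1) = 3)
    (htop : (⨆ kt : ι × Fin 2, Module.End.eigenspace (φ.baseChange ℂ)
      (if kt.2 = 0 then μ kt.1 else starRingEnd ℂ (μ kt.1))) = ⊤)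
    (𝔤 : Submodule ℚ (Module.End ℚ V)) (hbr : ∀ X ∈ 𝔤, ∀ X' ∈ 𝔤, X * X' - X' * X ∈ 𝔤)
    (hcomm : ∀ X ∈ 𝔤, ∀ a : H.endAlg, X * (a : Module.End ℚ V) = (a : Module.End ℚ V) * X)
    (hskew : ∀ X ∈ 𝔤, ∀ v w, ψ.form (X v) w + ψ.form v (X w) = 0)
    {Θ : Module.End ℂ (ℂ ⊗[ℚ] V)} (hΘ : ∀ p, ∀ x ∈ H.piece p (n - p), Θ x = ((2 * p - n : ℤ) : ℂ) • x)
    (hΘ𝔤 : Θ ∈ spanC 𝔤)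
    (hirr : ∀ k, ∀ U ≤ Module.End.eigenspace (φ.baseChange ℂ) (μ k),
      (∀ X ∈ 𝔤, ∀ u ∈ U, X.baseChange ℂ u ∈ U) → U = ⊥ ∨ U = Module.End.eigenspace (φ.baseChange ℂ) (μ k))
    (hmix : ∀ k, Module.finrank ℂ ↥(Module.End.eigenspace (φ.baseChange ℂ) (μ k) ⊓ H.piece 1 0) ≠ 0 ∧
      Module.finrank ℂ ↥(Module.End.eigenspace (φ.baseChange ℂ) (μ k) ⊓ H.piece 0 1) ≠ 0)
    (hwt : ∀ k k', ((Module.finrank ℂ ↥(Module.End.eigenspace (φ.baseChange ℂ) (μ k) ⊓ H.piece 1 0) : ℤ) -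
        Module.finrank ℂ ↥(Module.End.eigenspace (φ.baseChange ℂ) (μ k) ⊓ H.piece 0 1)) ^ 2 =
      ((Module.finrank ℂ ↥(Module.End.eigenspace (φ.baseChange ℂ) (μ k') ⊓ H.piece 1 0) : ℤ) -
        Module.finrank ℂ ↥(Module.End.eigenspace (φ.baseChange ℂ) (μ k') ⊓ H.piece 0 1)) ^ 2)
    (hnoWeil : ∀ y ∈ H.endAlg, y ≠ 0 → (∀ v w, ψ.form (y v) w + ψ.form v (y w) = 0) →
      (∃ q : ℚ, y * y = q • 1) → LinearMap.trace ℂ _ (y.baseChange ℂ * Θ) ≠ 0)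
    (k : ι) (Z : Module.End ℂ ↥(Module.End.eigenspace (φ.baseChange ℂ) (μ k))) (hZ : LinearMap.trace ℂ _ Z = 0) :
    ∃ X ∈ spanC 𝔤, (∀ w : ↥(Module.End.eigenspace (φ.baseChange ℂ) (μ k)), X w = Z w) ∧
      ∀ j, j ≠ k → ∀ w ∈ Module.End.eigenspace (φ.baseChange ℂ) (μ j), X w = 0 := by
  classical
  let W : ι → Submodule ℂ (ℂ ⊗[ℚ] V) := fun i => Module.End.eigenspace (φ.baseChange ℂ) (μ i)
  have hWdef : ∀ i, W i = Module.End.eigenspace (φ.baseChange ℂ) (μ i) := fun i => rfl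
  let 𝔡 : Submodule ℚ (Module.End ℚ V) := Submodule.span ℚ {B | ∃ X ∈ 𝔤, ∃ X' ∈ 𝔤, X * X' - X' * X = B}
  have h𝔡𝔤 : 𝔡 ≤ 𝔤 := CMDerived.derived_le hbr
  have h𝔇𝔊 : spanC 𝔡 ≤ spanC 𝔤 := spanC_mono h𝔡𝔤
  have hSφ : ∀ Y ∈ spanC 𝔤, Y * φ.baseChange ℂ = φ.baseChange ℂ * Y := fun Y hY =>
    UnitaryTheta.commute_of_mem_spanC H hφE hcomm hY
  have hSW : ∀ Y ∈ spanC 𝔤, ∀ i, ∀ w ∈ W i, Y w ∈ W i := fun Y hY i w hw =>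
    UnitaryTheta.apply_mem_eigenspace_of_commute (hSφ Y hY) hw
  have hXW : ∀ X ∈ 𝔤, ∀ i, ∀ w ∈ W i, X.baseChange ℂ w ∈ W i := fun X hX i w hw =>
    UnitaryTheta.apply_mem_eigenspace_of_commute (UnitaryTheta.baseChange_commute H hφE hcomm hX) hw
  have hΘφ : Θ * φ.baseChange ℂ = φ.baseChange ℂ * Θ := hSφ Θ hΘ𝔤
  have hΘskew := ThetaSubalgebra.formBaseChange_add_eq_zero_of_mem_spanC ψ hskew hΘ𝔤
  have hfin : ∀ i, Module.finrank ℂ ↥(W i) = 3 := fun i => by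
    rw [hWdef, CMTheta.finrank_eigenspace_eq_add H hn heff hφE, hrank i]
  haveI : ∀ i, Module.Finite ℂ ↥(W i) := fun i => Module.finite_of_finrank_eq_succ (hfin i)
  let bW : ∀ i, Module.Basis (Fin 3) ℂ ↥(W i) := fun i => Module.finBasisOfFinrankEq ℂ _ (hfin i)
  -- the complex derived span `𝔇` and the inputs of Ribet's lemma
  have hbr𝔇 : ∀ X ∈ spanC 𝔡, ∀ Y ∈ spanC 𝔡, X * Y - Y * X ∈ spanC 𝔡 := fun X hX Y hY =>
    commutator_mem_spanC_derived (h𝔇𝔊 hX) (h𝔇𝔊 hY)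
  have hW𝔇 : ∀ X ∈ spanC 𝔡, ∀ i, ∀ w ∈ W i, X w ∈ W i := fun X hX i => hSW X (h𝔇𝔊 hX) i
  have htr𝔇 : ∀ X (hX : X ∈ spanC 𝔡) i, LinearMap.trace ℂ _ (X.restrict (hW𝔇 X hX i)) = 0 := fun X hX i =>
    CMDerived.trace_restrict_eq_zero (fun Y hY => hXW Y hY i) hX _
  have hproj : ∀ i, ∀ Z : Module.End ℂ ↥(W i), LinearMap.trace ℂ _ Z = 0 → ∃ X ∈ spanC 𝔡, ∀ w : ↥(W i), X w = Z w :=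
    fun i Z hZ => CMNoTwist3.proj_of_mixed H hn heff hφE 𝔤 hbr hcomm hΘ hΘ𝔤 (hirr i) (hrank i) (hmix i).1 (hmix i).2 Z hZ
  have P := fun i₀ => Literature.Algebra.Lie.LieGoursatTwist.lift_or_twist_of_submodules (k := ℂ) W (d := 3)
    (by norm_num) bW (spanC 𝔡) hbr𝔇 hW𝔇 htr𝔇 hproj i₀
  -- the dichotomy at `k`: a twist is excluded by the envelope and the arithmetic end
  rcases P k with h | ⟨j, hj, e, A, hA, htw⟩
  · obtain ⟨X, hX, h1, h2⟩ := h Z hZ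
    exact ⟨X, h𝔇𝔊 hX, h1, h2⟩
  exfalso
  obtain ⟨t, htE, htns, α, β, hα, hβ, hrel⟩ := CMTwist.exists_mem_endAlg_of_twist hι H hn heff ψ hφE hE μ hinj hdist
    hrank htop 𝔤 hbr hcomm hskew hΘ hΘ𝔤 hW𝔇 bW k (hmix k) (hproj k) j hj e A hA htw
  exact CMNoTwist3.false_of_twist_scalars hι H hn heff ψ hφE hE hdiv μ hinj hdist three_ne_zero hrank htop hΘ hΘφ
    hΘskew k j hj (hwt k j) hnoWeil htE htns hα hβ hrel

end Hodge

end HodgeStructure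

end Literature.AlgebraicGeometry.Motives
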